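import Literature.Probability.LatticeModels.GlauberDynamicsLogSobolevBounds
import Literature.Probability.LatticeModels.GlauberTwoBlockGap
import HarnessLib

/-!
# The conditional entropy decomposition ([Mar99] Theorem 4.6, (4.20)), PROVED

Topic `Literature/Probability/LatticeModels`; cell `ym-ir`, seat lit-3 (census rows B2/B4).  Theorems only
(D-0026).  [Mar99] Theorem 4.6, proof, (4.20) p0190 L20–27: for `B ⊆ V` and a positive bounded `f`,
`μ_V^τ(f² log f) = μ_V^τ(μ_B(f² log f)) ≤ [sup_σ c_s(μ_B^σ)] · ½ μ_V^τ(|∇_B f|²) + μ_V^τ(g² log g)`,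
`g = (μ_B(f²))^{1/2}` — the DLR equation plus the log-Sobolev inequality in `B` uniformly in the boundary
condition.  First brick of the [Mar99] Theorem 4.6 recursion (the typed fact `Glauber.Martinelli1999_thm4_6`,
NOT proved here; the remaining bricks are Proposition 3.11 — PROVED as `Glauber.Martinelli1999_prop3_11` — the
density input `Glauber.abs_spec_real_sub_union_le_of_local_SMT'`, and the «key» Lemma 4.7).  SIBLING-SETTING
result (`±1` spins); the Yang–Mills gap is not touched. [cite: Martinelli1999, Theorem 4.6, proof, (4.20)]
-/

open MeasureTheory ProbabilityTheory Finset Filter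

noncomputable section

namespace Literature.Probability.LatticeModels

namespace Glauber

variable {d : ℕ} {γ : Specification (Site d) ℤˣ}

/-- `|y log √y| ≤ C² |log C| + 1` for `0 ≤ y ≤ C²` (the entropy integrand at `g = √y`).
[cite: Martinelli1999, Theorem 4.6, proof, (4.20)] -/
theorem abs_mul_log_sqrt_le {y C : ℝ} (hy : 0 ≤ y) (hC : 0 ≤ C) (hyC : y ≤ C ^ 2) :
    |y * Real.log (Real.sqrt y)| ≤ C ^ 2 * |Real.log C| + 1 := by
  rcases hy.eq_or_lt with h0 | hpos
  · rw [← h0]; simp; positivity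
  · have hs : 0 < Real.sqrt y := Real.sqrt_pos.2 hpos
    have hsC : Real.sqrt y ≤ C := by
      rw [Real.sqrt_le_left hC] at *; exact hyC
    have h := abs_sq_mul_log_le hs hsC
    rwa [Real.sq_sqrt hy] at h

/-- **[Mar99] (4.20), conditional entropy decomposition**: for `B ⊆ V`, a log-Sobolev inequality with
constant `c` for every `μ_B^σ`, and a positive bounded measurable `f`,
`μ_V^τ(f² log f) ≤ c · ½ μ_V^τ(|∇_B f|²) + μ_V^τ(μ_B(f²) log √(μ_B(f²)))`.
[cite: Martinelli1999, Theorem 4.6, proof, (4.20)] -/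
theorem integral_sq_mul_log_le_of_condLSI (hγ : IsSpecification γ) {B V : Finset (Site d)} (hBV : B ⊆ V)
    (τ : Site d → ℤˣ) {c : ℝ} (hLSI : ∀ σ : Site d → ℤˣ, LogSobolevIneq (γ B σ) B c)
    {f : (Site d → ℤˣ) → ℝ} (hf : Measurable f) {C : ℝ} (hC : ∀ σ, |f σ| ≤ C) (hpos : ∀ σ, 0 < f σ) :
    ∫ σ, f σ ^ 2 * Real.log (f σ) ∂(γ V τ) ≤
      c * ((1 / 2) * ∫ σ, gradSq B f σ ∂(γ V τ)) +
        ∫ σ, bavg γ B (fun ω => f ω ^ 2) σ * Real.log (Real.sqrt (bavg γ B (fun ω => f ω ^ 2) σ)) ∂(γ V τ) := by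
  haveI : IsProbabilityMeasure (γ V τ) := hγ.isProbability V τ
  have hC0 : 0 ≤ C := (abs_nonneg _).trans (hC τ)
  have hfC : ∀ σ, f σ ≤ C := fun σ => (le_abs_self _).trans (hC σ)
  -- bounds
  have hent : ∀ σ, |f σ ^ 2 * Real.log (f σ)| ≤ C ^ 2 * |Real.log C| + 1 := fun σ =>
    abs_sq_mul_log_le (hpos σ) (hfC σ)
  have hsqB : ∀ σ, |f σ ^ 2| ≤ C ^ 2 := fun σ => by
    rw [abs_pow]; exact pow_le_pow_left₀ (abs_nonneg _) (hC σ) 2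
  have hgradB : ∀ σ, |gradSq B f σ| ≤ 4 * B.card * C ^ 2 := fun σ => by
    rw [abs_of_nonneg (gradSq_nonneg _ _ _)]; exact gradSq_le B hC σ
  have hment : Measurable fun σ => f σ ^ 2 * Real.log (f σ) := (hf.pow_const 2).mul hf.log
  have hmsq : Measurable fun σ => f σ ^ 2 := hf.pow_const 2
  -- DLR for the entropy and the Dirichlet form
  have h1 : ∫ σ, f σ ^ 2 * Real.log (f σ) ∂(γ V τ) =
      ∫ σ, bavg γ B (fun ω => f ω ^ 2 * Real.log (f ω)) σ ∂(γ V τ) :=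
    (integral_integral_spec hγ hBV τ hment hent).symm
  have h2 : ∫ σ, gradSq B f σ ∂(γ V τ) = ∫ σ, bavg γ B (gradSq B f) σ ∂(γ V τ) :=
    (integral_integral_spec hγ hBV τ (measurable_gradSq B hf) hgradB).symm
  rw [h1, h2]
  -- pointwise log-Sobolev inequality in `B`
  have hpt : ∀ σ, bavg γ B (fun ω => f ω ^ 2 * Real.log (f ω)) σ ≤
      c * ((1 / 2) * bavg γ B (gradSq B f) σ) +
        bavg γ B (fun ω => f ω ^ 2) σ * Real.log (Real.sqrt (bavg γ B (fun ω => f ω ^ 2) σ)) := by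
    intro σ
    have h := hLSI σ f hf ⟨C, hC⟩ hpos
    unfold dirichletForm at h
    exact h
  -- integrate
  have hbavg_nonneg : ∀ σ, 0 ≤ bavg γ B (fun ω => f ω ^ 2) σ := fun σ => integral_nonneg fun ω => sq_nonneg _
  have hbavg_le : ∀ σ, bavg γ B (fun ω => f ω ^ 2) σ ≤ C ^ 2 := fun σ =>
    (le_abs_self _).trans (abs_bavg_le hγ B hsqB σ)
  have hiL : Integrable (bavg γ B (fun ω => f ω ^ 2 * Real.log (f ω))) (γ V τ) :=
    Integrable.of_bound (measurable_bavg hγ B hment).aestronglyMeasurable (C ^ 2 * |Real.log C| + 1)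
      (Eventually.of_forall fun σ => by rw [Real.norm_eq_abs]; exact abs_bavg_le hγ B hent σ)
  have hiG : Integrable (fun σ => c * ((1 / 2) * bavg γ B (gradSq B f) σ)) (γ V τ) :=
    ((Integrable.of_bound (measurable_bavg hγ B (measurable_gradSq B hf)).aestronglyMeasurable
      (4 * B.card * C ^ 2) (Eventually.of_forall fun σ => by
        rw [Real.norm_eq_abs]; exact abs_bavg_le hγ B hgradB σ)).const_mul (1 / 2)).const_mul c
  have hmE : Measurable fun σ => bavg γ B (fun ω => f ω ^ 2) σ *
      Real.log (Real.sqrt (bavg γ B (fun ω => f ω ^ 2) σ)) :=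
    (measurable_bavg hγ B hmsq).mul (measurable_bavg hγ B hmsq).sqrt.log
  have hiE : Integrable (fun σ => bavg γ B (fun ω => f ω ^ 2) σ *
      Real.log (Real.sqrt (bavg γ B (fun ω => f ω ^ 2) σ))) (γ V τ) :=
    Integrable.of_bound hmE.aestronglyMeasurable (C ^ 2 * |Real.log C| + 1)
      (Eventually.of_forall fun σ => by
        rw [Real.norm_eq_abs]; exact abs_mul_log_sqrt_le (hbavg_nonneg σ) hC0 (hbavg_le σ))
  have h3 : ∫ σ, bavg γ B (fun ω => f ω ^ 2 * Real.log (f ω)) σ ∂(γ V τ) ≤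
      ∫ σ, (c * ((1 / 2) * bavg γ B (gradSq B f) σ) +
        bavg γ B (fun ω => f ω ^ 2) σ * Real.log (Real.sqrt (bavg γ B (fun ω => f ω ^ 2) σ))) ∂(γ V τ) :=
    integral_mono hiL (hiG.add hiE) hpt
  rw [integral_add hiG hiE, integral_const_mul, integral_const_mul] at h3
  exact h3

end Glauber

end Literature.Probability.LatticeModels

end
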